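import Mathlib
import HarnessLib
import Summits.Ventures.LatticeQCDFlow.Exactness.SphereOrbitLaw

/-!
# The frame map `(O, q) ↦ (O e, O q)` sends `Haar(SO(d)) ⊗ Lebesgue` to `uniformSphere ⊗ Lebesgue`; the momentum kick and flip are fibre shears

HONEST FRAMING: exact (Metropolis-corrected) sampling algorithms for lattice gauge theory;
figures of merit are autocorrelation/cost numbers at stated couplings and volumes; no
continuum-physics claim.

Venture `LatticeQCDFlow` (cell pub-lqcd), topic `Exactness`; FANOUT row 7 (`s0-cpn-null`: the
S0-D1 rung — 2D CP⁹ HMC and THMC, both run with the molecular dynamics of Engel–Schaefer §2.2 on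
the site spheres).  NEW WORK of the cell over Mathlib (`MeasurePreserving.skew_product`,
`LinearIsometryEquiv.measurePreserving`, translation/negation invariance of Lebesgue measure) and
row 9's `SphereOrbitLaw.lean` (`rotIso`, `actSO`, **`orbitLaw_eq_uniformSphere`**: the law of `O e`
under the Haar probability of `SO(d)` is the uniform probability of the sphere, `d ≥ 2`) with its
imports `CompactHaar.lean` / `GaugeGroups.lean` (Haar on the compact group `SO(d)`).  Nothing is
cited as a fact.  Printed counterpart, NAMED ONLY: Engel–Schaefer, Comput. Phys. Commun. 182 (2011)
2107, §2.2 eqs. (9)–(10) (momenta and the projected-force kick of CP(N−1) HMC).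

This is the first half of "hypothesis 2 of `involMH` for the sphere leapfrog" (Liouville), listed
as NOT CLAIMED in row 7's `SphereGeodesicDrift.lean`, in the PRODUCT form that the tree's HMC
theorem `MomentumRefresh.hmc_config_exact` consumes: phase space `S^{d−1} × ℝ^d` (position on the
unit sphere of `E = EuclideanSpace ℝ m`, AMBIENT momentum `p ∈ E`; the tangential part
`p − ⟪x,p⟫x` is the E–S momentum, the normal component is inert), reference measure
`uniformSphere ⊗ Lebesgue`.  The second half — the geodesic drift — is `SphereDriftLift.lean`,
which lifts the drift through the frame map of §1.

## Content (`m` finite, `E = EuclideanSpace ℝ m`, `S` its unit sphere, `SO = specialOrthogonalGroup m ℝ`)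

* §0 `MeasurePreserving.skew_product_snd` — Mathlib's skew product, fibred over the second factor.
* §1 `rotSO O : E ≃ₗᵢ[ℝ] E`, `rotSO_mul`, `coe_actSO_eq_rotSO`, `continuous_rotSO₂`;
  **`frameMap e (O, q) = (O e, O q)`**, `continuous_frameMap`, and **`measurePreserving_frameMap`**
  (`card m ≥ 2`): `frameMap e` pushes `Haar(SO(d)) ⊗ Lebesgue` forward to `uniformSphere ⊗ Lebesgue`
  (a skew product — `q ↦ O q` preserves Lebesgue for each `O` — then the orbit law).
* §2 `ambientKick F δ (x, p) = (x, p + δ F x)`, `ambientFlip (x, p) = (x, −p)`,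
  **`measurePreserving_ambientKick`** (any measurable `F`, any s-finite position law `σ`),
  `ambientFlip_ambientFlip`, **`measurePreserving_ambientFlip`** — translations / negation of the
  momentum fibre over each position (Fubini).

NOT CLAIMED here: the drift (next file); any identification with the Riemannian Liouville measure
of `TS^{d−1}` (a normalisation dictionary nothing downstream needs); `card m = 1`.
-/

noncomputable section

namespace Summit.Ventures.LatticeQCDFlow.Exactness

open MeasureTheory Measure Metric Set Matrix WithLp Real
open scoped ENNReal InnerProductSpace

/-! ## §0 A measure-theoretic tool -/

section Tools

variable {α β γ : Type*} [MeasurableSpace α] [MeasurableSpace β] [MeasurableSpace γ]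

/-- **Skew product over the second factor**: if every `g c` preserves `μa` and `g` is jointly
measurable then `(a, c) ↦ (g c a, c)` preserves `μa ⊗ μc`. -/
theorem MeasurePreserving.skew_product_snd {μa : Measure α} {μc : Measure γ} [SFinite μa]
    [SFinite μc] {g : γ → α → α} (hgm : Measurable (Function.uncurry g))
    (hg : ∀ c, Measure.map (g c) μa = μa) :
    MeasurePreserving (fun p : α × γ => (g p.2 p.1, p.2)) (μa.prod μc) (μa.prod μc) := by
  have h1 : MeasurePreserving (fun p : γ × α => (p.1, g p.1 p.2)) (μc.prod μa) (μc.prod μa) :=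
    (MeasurePreserving.id μc).skew_product hgm (ae_of_all _ hg)
  have h2 := (Measure.measurePreserving_swap (μ := μc) (ν := μa)).comp
    (h1.comp (Measure.measurePreserving_swap (μ := μa) (ν := μc)))
  exact h2

end Tools

/-! ## §1 The frame map and its law -/

section Frame

variable {m : Type*} [Fintype m] [DecidableEq m]

/-- An element of `SO(d)` acting on `E` as a linear isometry. -/
def rotSO (O : (Matrix.specialOrthogonalGroup m ℝ)) : (EuclideanSpace ℝ m) ≃ₗᵢ[ℝ] (EuclideanSpace ℝ m) := rotIso (O : Matrix m m ℝ) (mem_orthogonalGroup_of_SO O)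

/-- Coordinates of the action. -/
theorem rotSO_apply (O : (Matrix.specialOrthogonalGroup m ℝ)) (x : (EuclideanSpace ℝ m)) : rotSO O x = toLp 2 ((O : Matrix m m ℝ) *ᵥ ofLp x) :=
  rotIso_apply _ x

/-- The action is multiplicative. -/
theorem rotSO_mul (O O' : (Matrix.specialOrthogonalGroup m ℝ)) (x : (EuclideanSpace ℝ m)) : rotSO (O * O') x = rotSO O (rotSO O' x) := by
  rw [rotSO_apply, rotSO_apply, rotSO_apply, Submonoid.coe_mul, ← mulVec_mulVec, ofLp_toLp]

/-- The sphere action of `SphereOrbitLaw.lean` in terms of `rotSO`. -/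
theorem coe_actSO_eq_rotSO (O : (Matrix.specialOrthogonalGroup m ℝ)) (s : (sphere (0 : EuclideanSpace ℝ m) 1)) : (actSO O s : (EuclideanSpace ℝ m)) = rotSO O s := by
  rw [coe_actSO, rotSO_apply]

/-- Joint continuity of `(O, x) ↦ O x`. -/
theorem continuous_rotSO₂ : Continuous fun p : (Matrix.specialOrthogonalGroup m ℝ) × (EuclideanSpace ℝ m) => rotSO p.1 p.2 := by
  have h : Continuous fun p : (Matrix.specialOrthogonalGroup m ℝ) × (EuclideanSpace ℝ m) => (toLp 2 ((p.1 : Matrix m m ℝ) *ᵥ ofLp p.2) : (EuclideanSpace ℝ m)) :=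
    (PiLp.continuous_toLp 2 _).comp
      ((continuous_subtype_val.comp continuous_fst).matrix_mulVec
        ((PiLp.continuous_ofLp 2 _).comp continuous_snd))
  have heq : (fun p : (Matrix.specialOrthogonalGroup m ℝ) × (EuclideanSpace ℝ m) => rotSO p.1 p.2) =
      fun p : (Matrix.specialOrthogonalGroup m ℝ) × (EuclideanSpace ℝ m) => (toLp 2 ((p.1 : Matrix m m ℝ) *ᵥ ofLp p.2) : (EuclideanSpace ℝ m)) := by
    funext p; exact rotSO_apply p.1 p.2
  rw [heq]; exact h

/-- **The frame map**: a frame `O` and a body-frame vector `q` give the phase-space point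
`(O e, O q)` — position = image of the body axis `e`, ambient momentum = image of `q`. -/
def frameMap (e : (sphere (0 : EuclideanSpace ℝ m) 1)) (p : (Matrix.specialOrthogonalGroup m ℝ) × (EuclideanSpace ℝ m)) : (sphere (0 : EuclideanSpace ℝ m) 1) × (EuclideanSpace ℝ m) := (actSO p.1 e, rotSO p.1 p.2)

/-- The frame map is continuous. -/
theorem continuous_frameMap (e : (sphere (0 : EuclideanSpace ℝ m) 1)) : Continuous (frameMap e) :=
  (continuous_actSO.comp (continuous_fst.prodMk continuous_const)).prodMk continuous_rotSO₂

variable [Nonempty m]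

/-- **The law of the frame map**: `frameMap e` pushes `Haar(SO(d)) ⊗ Lebesgue` to
`uniformSphere ⊗ Lebesgue` (`d = card m ≥ 2`).  A skew product (`q ↦ O q` preserves Lebesgue for
each `O`) followed by the orbit law `orbitLaw_eq_uniformSphere`. -/
theorem measurePreserving_frameMap (h2 : 2 ≤ Fintype.card m) (e : (sphere (0 : EuclideanSpace ℝ m) 1)) :
    MeasurePreserving (frameMap e) (((Literature.MathematicalPhysics.QuantumFieldTheory.haarProbability (Matrix.specialOrthogonalGroup m ℝ))).prod (volume : Measure (EuclideanSpace ℝ m)))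
      ((uniformSphere (volume : Measure (EuclideanSpace ℝ m))).prod (volume : Measure (EuclideanSpace ℝ m))) := by
  have hgm : Measurable (Function.uncurry fun (O : (Matrix.specialOrthogonalGroup m ℝ)) (q : (EuclideanSpace ℝ m)) => rotSO O q) :=
    continuous_rotSO₂.measurable
  have hg : ∀ O : (Matrix.specialOrthogonalGroup m ℝ), Measure.map (rotSO O) (volume : Measure (EuclideanSpace ℝ m)) = volume := fun O =>
    (rotSO O).measurePreserving.map_eq
  have h1 : MeasurePreserving (fun p : (Matrix.specialOrthogonalGroup m ℝ) × (EuclideanSpace ℝ m) => (id p.1, rotSO p.1 p.2))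
      (((Literature.MathematicalPhysics.QuantumFieldTheory.haarProbability (Matrix.specialOrthogonalGroup m ℝ))).prod (volume : Measure (EuclideanSpace ℝ m))) (((Literature.MathematicalPhysics.QuantumFieldTheory.haarProbability (Matrix.specialOrthogonalGroup m ℝ))).prod (volume : Measure (EuclideanSpace ℝ m))) :=
    (MeasurePreserving.id _).skew_product (g := fun (O : (Matrix.specialOrthogonalGroup m ℝ)) (q : (EuclideanSpace ℝ m)) => rotSO O q) hgm
      (ae_of_all _ hg)
  have horb' : orbitLaw e = uniformSphere (volume : Measure (EuclideanSpace ℝ m)) := orbitLaw_eq_uniformSphere h2 e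
  rw [orbitLaw] at horb'
  have horb : MeasurePreserving (fun O : (Matrix.specialOrthogonalGroup m ℝ) => actSO O e) (Literature.MathematicalPhysics.QuantumFieldTheory.haarProbability (Matrix.specialOrthogonalGroup m ℝ)) (uniformSphere (volume : Measure (EuclideanSpace ℝ m))) :=
    ⟨measurable_actSO_left e, horb'⟩
  have h3 := (horb.prod (MeasurePreserving.id (volume : Measure (EuclideanSpace ℝ m)))).comp h1
  exact h3

end Frame

/-! ## §2 The kick and the flip are fibre shears -/

section KickFlip

variable {m : Type*} [Fintype m] [DecidableEq m]

/-- The momentum KICK with ambient momenta: `(x, p) ↦ (x, p + δ F x)` (E–S eq. (10) when `F` is the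
sphere-projected force; no tangency is needed for measure preservation). -/
def ambientKick (F : (EuclideanSpace ℝ m) → (EuclideanSpace ℝ m)) (δ : ℝ) (z : (sphere (0 : EuclideanSpace ℝ m) 1) × (EuclideanSpace ℝ m)) : (sphere (0 : EuclideanSpace ℝ m) 1) × (EuclideanSpace ℝ m) := (z.1, z.2 + δ • F z.1)

omit [DecidableEq m] in
/-- **The kick preserves `σ ⊗ Lebesgue`** for every s-finite law `σ` of the position (a translation
of the momentum fibre over each `x`; Fubini). -/
theorem measurePreserving_ambientKick {F : (EuclideanSpace ℝ m) → (EuclideanSpace ℝ m)} (hF : Measurable F) (δ : ℝ) (σ : Measure (sphere (0 : EuclideanSpace ℝ m) 1))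
    [SFinite σ] :
    MeasurePreserving (ambientKick F δ) (σ.prod (volume : Measure (EuclideanSpace ℝ m))) (σ.prod (volume : Measure (EuclideanSpace ℝ m))) := by
  have hg : Measurable (Function.uncurry fun (x : (sphere (0 : EuclideanSpace ℝ m) 1)) (p : (EuclideanSpace ℝ m)) => p + δ • F x) :=
    measurable_snd.add ((hF.comp (measurable_subtype_coe.comp measurable_fst)).const_smul δ)
  have h := (MeasurePreserving.id σ).skew_product (g := fun (x : (sphere (0 : EuclideanSpace ℝ m) 1)) (p : (EuclideanSpace ℝ m)) => p + δ • F x) hg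
    (ae_of_all _ fun x => (measurePreserving_add_right (volume : Measure (EuclideanSpace ℝ m)) (δ • F x)).map_eq)
  exact h

/-- The momentum FLIP with ambient momenta: `(x, p) ↦ (x, −p)`. -/
def ambientFlip (z : (sphere (0 : EuclideanSpace ℝ m) 1) × (EuclideanSpace ℝ m)) : (sphere (0 : EuclideanSpace ℝ m) 1) × (EuclideanSpace ℝ m) := (z.1, -z.2)

omit [DecidableEq m] in
/-- The flip is an involution. -/
@[simp] theorem ambientFlip_ambientFlip (z : (sphere (0 : EuclideanSpace ℝ m) 1) × (EuclideanSpace ℝ m)) : ambientFlip (ambientFlip z) = z := by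
  simp [ambientFlip]

omit [DecidableEq m] in
/-- **The flip preserves `σ ⊗ Lebesgue`.** -/
theorem measurePreserving_ambientFlip (σ : Measure (sphere (0 : EuclideanSpace ℝ m) 1)) [SFinite σ] :
    MeasurePreserving ambientFlip (σ.prod (volume : Measure (EuclideanSpace ℝ m))) (σ.prod (volume : Measure (EuclideanSpace ℝ m))) :=
  (MeasurePreserving.id σ).prod (Measure.measurePreserving_neg (volume : Measure (EuclideanSpace ℝ m)))

end KickFlip

end Summit.Ventures.LatticeQCDFlow.Exactness

end
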